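import Literature.Geometry.Lorentzian.LinearConstraintMoments
import HarnessLib

/-!
# Trace reversal: the linear parts of the constraints in Mao–Oh–Tao's variables `(h, π)`

(trunk G08 = T-LORENTZ; family `gr`; namespace `Literature.Geometry.Lorentzian.MaoOhTao`.)

Mao–Oh–Tao (arXiv:2308.13031), §2.1: with `(h_{ij}, π_{ij}) = (g_{ij} − δ_{ij} − δ_{ij} tr_δ(g − δ), k_{ij} − δ_{ij} tr_δ k)` (2.1),
inverted by `(g_{ij}, k_{ij}) = (δ_{ij} + h_{ij} − ½ δ_{ij} tr_δ h, π_{ij} − ½ δ_{ij} tr_δ π)` (2.2), the constraint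
equations take the form `∂_i∂_j h^{ij} = M(…)`, `∂_i π^{ij} = N^j(…)` (2.6)–(2.7), i.e. the LINEAR parts of the scalar
curvature and of the momentum constraint become the double divergence and the divergence.  The linearised constraint
map at the flat background is `DΦ_{(δ,0)}(γ, κ) = (div div γ − Δ tr_δ γ, div κ − d tr_δ κ)` (`CoordFlatBackground.lean`,
`linScalAt_innerSL`, `linMomFn_innerSL_zero`); this file records the two trace-reversal identities behind (2.6)–(2.7),
for component functions on `ℝ³`:

* `sum_sum_pd_pd_traceRev_sub_lap_eq` — with `γ_{kj} = h_{kj} − ½ δ_{kj} tr h` (so `tr γ = Σ_i (h_{ii} − ½ tr h)`):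
  `Σ_{j,k} ∂_j∂_k γ_{kj} − Σ_j ∂_j∂_j (tr γ) = Σ_{j,k} ∂_j∂_k h_{kj}` (`tr γ = −½ tr h`);
* `sum_pd_traceRev_sub_pd_eq` — with `κ_{kj} = π_{kj} − ½ δ_{kj} tr π`:
  `Σ_k ∂_k κ_{kj} − ∂_j (tr κ) = Σ_k ∂_k π_{kj}` (`tr κ = −½ tr π`);
* `traceRev_traceRev'` — (2.1) and (2.2) are inverse to each other: `γ = h − ½ δ tr h ⟺ h = γ − δ tr γ`.

Everything is proved; no definitions, no named facts.

## References

* Y. Mao, S.-J. Oh, T. Tao, arXiv:2308.13031 (2023), §2.1, (2.1)–(2.2), (2.3), (2.5), (2.6)–(2.7) (key `MaoOhTao2023`).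
-/

noncomputable section

open scoped Topology ContDiff
open Set Function

namespace Literature.Geometry.Lorentzian

namespace MaoOhTao

variable {x : E3} {m : Fin 3}

/-- `∂_m (c f) = c ∂_m f` at a point of differentiability. [folklore] -/
theorem pd_const_mul' (c : ℝ) {f : E3 → ℝ} (hf : DifferentiableAt ℝ f x) :
    pd m (fun y ↦ c * f y) x = c * pd m f x := by
  simp only [pd, fderiv_const_mul hf c, FunLike.coe_smul, Pi.smul_apply, smul_eq_mul]

/-- **Trace of a trace-reversed field**: `tr(h − ½ δ tr h) = −½ tr h` on `ℝ³`. [cite: MaoOhTao2023, §2.1, (2.1)–(2.2)] -/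
theorem sum_traceRev_diag (H : Fin 3 → Fin 3 → E3 → ℝ) (y : E3) :
    ∑ i, (H i i y - (1 / 2 : ℝ) * (∑ l, H l l y)) = -(1 / 2 : ℝ) * ∑ l, H l l y := by
  simp only [Finset.sum_sub_distrib, Finset.sum_const, Finset.card_univ, Fintype.card_fin, nsmul_eq_mul]
  ring

/-- **(2.1) and (2.2) are mutually inverse**: if `γ_{ij} = h_{ij} − ½ δ_{ij} tr h` then `h_{ij} = γ_{ij} − δ_{ij} tr γ`.
[cite: MaoOhTao2023, §2.1, (2.1)–(2.2)] -/
theorem traceRev_traceRev' (H : Fin 3 → Fin 3 → E3 → ℝ) (i j : Fin 3) (y : E3) :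
    (H i j y - (1 / 2 : ℝ) * (if i = j then ∑ l, H l l y else 0)) -
        (if i = j then ∑ l', (H l' l' y - (1 / 2 : ℝ) * (∑ l, H l l y)) else 0) =
      H i j y := by
  rw [sum_traceRev_diag]
  by_cases h : i = j
  · subst h
    simp only [if_true]
    ring
  · simp [h]

section Scalar

variable {H : Fin 3 → Fin 3 → E3 → ℝ}

/-- **Trace reversal for the double divergence** (linear part of (2.3) ⇒ (2.6)): for `h_{kj} ∈ C²` and
`γ_{kj} = h_{kj} − ½ δ_{kj} tr h`,
`Σ_{j,k} ∂_j∂_k γ_{kj} − Σ_j ∂_j∂_j (tr γ) = Σ_{j,k} ∂_j∂_k h_{kj}`: the linearised scalar curvature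
`div div γ − Δ tr γ` of `δ + γ` is the double divergence of `h`. [cite: MaoOhTao2023, §2.1, (2.3), (2.6)] -/
theorem sum_sum_pd_pd_traceRev_sub_lap_eq (hH : ∀ i j, ContDiff ℝ 2 (H i j)) (x : E3) :
    (∑ j, ∑ k, pd j (pd k (fun y ↦ H k j y - (1 / 2 : ℝ) * (if k = j then ∑ l, H l l y else 0))) x) -
        ∑ j, pd j (pd j (fun y ↦ ∑ i, (H i i y - (1 / 2 : ℝ) * (∑ l, H l l y)))) x =
      ∑ j, ∑ k, pd j (pd k (H k j)) x := by
  -- the trace `T = Σ_l h_{ll}` and its derivatives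
  set T : E3 → ℝ := fun y ↦ ∑ l, H l l y with hT
  have hTd : ContDiff ℝ 2 T := ContDiff.sum fun l _ ↦ hH l l
  have hd1 : ∀ i j y, DifferentiableAt ℝ (H i j) y := fun i j y ↦ (hH i j).differentiable two_ne_zero y
  have hTd1 : ∀ y, DifferentiableAt ℝ T y := fun y ↦ hTd.differentiable two_ne_zero y
  have hpdH : ∀ i j k, Differentiable ℝ (pd k (H i j)) := fun i j k ↦
    (contDiff_pd (n := 1) (hH i j) k).differentiable one_ne_zero
  have hpdT : ∀ k, Differentiable ℝ (pd k T) := fun k ↦ (contDiff_pd (n := 1) hTd k).differentiable one_ne_zero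
  -- first derivatives of the trace-reversed components
  have h1 : ∀ j k, pd k (fun y ↦ H k j y - (1 / 2 : ℝ) * (if k = j then ∑ l, H l l y else 0)) =
      fun y ↦ pd k (H k j) y - (1 / 2 : ℝ) * (if k = j then pd k T y else 0) := by
    intro j k
    funext y
    have hc : DifferentiableAt ℝ (fun y ↦ (1 / 2 : ℝ) * (if k = j then ∑ l, H l l y else 0)) y := by
      by_cases hkj : k = j
      · simp only [hkj, if_true]; exact (hTd1 y).const_mul _
      · simp only [hkj, if_false, mul_zero]; exact differentiableAt_const _
    rw [pd_sub (hd1 k j y) hc]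
    by_cases hkj : k = j
    · simp only [hkj, if_true]
      rw [pd_const_mul' _ (hTd1 y)]
    · simp only [hkj, if_false, mul_zero]
      simp [pd]
  -- second derivatives
  have h2 : ∀ j k, pd j (pd k (fun y ↦ H k j y - (1 / 2 : ℝ) * (if k = j then ∑ l, H l l y else 0))) x =
      pd j (pd k (H k j)) x - (1 / 2 : ℝ) * (if k = j then pd j (pd k T) x else 0) := by
    intro j k
    rw [h1 j k]
    have hc : DifferentiableAt ℝ (fun y ↦ (1 / 2 : ℝ) * (if k = j then pd k T y else 0)) x := by
      by_cases hkj : k = j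
      · simp only [hkj, if_true]; exact ((hpdT j) x).const_mul _
      · simp only [hkj, if_false, mul_zero]; exact differentiableAt_const _
    rw [pd_sub ((hpdH k j k) x) hc]
    by_cases hkj : k = j
    · simp only [hkj, if_true]
      rw [pd_const_mul' _ ((hpdT j) x)]
    · simp only [hkj, if_false, mul_zero]
      simp [pd]
  -- the trace of the reversed field is `−½ T`
  have h3 : (fun y ↦ ∑ i, (H i i y - (1 / 2 : ℝ) * (∑ l, H l l y))) =
      fun y ↦ -(1 / 2 : ℝ) * T y := funext fun y ↦ sum_traceRev_diag H y
  have h4 : ∀ j, pd j (pd j (fun y ↦ -(1 / 2 : ℝ) * T y)) x = -(1 / 2 : ℝ) * pd j (pd j T) x := by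
    intro j
    have : pd j (fun y ↦ -(1 / 2 : ℝ) * T y) = fun y ↦ -(1 / 2 : ℝ) * pd j T y :=
      funext fun y ↦ pd_const_mul' _ (hTd1 y)
    rw [this, pd_const_mul' _ ((hpdT j) x)]
  rw [h3]
  simp only [h2, h4]
  simp only [Finset.sum_sub_distrib, mul_ite, mul_zero, Finset.sum_ite_eq', Finset.mem_univ, if_true,
    ← Finset.mul_sum]
  ring

end Scalar

section Momentum

variable {P : Fin 3 → Fin 3 → E3 → ℝ}

/-- **Trace reversal for the divergence** (linear part of (2.5) ⇒ (2.7)): for `π_{kj} ∈ C¹` and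
`κ_{kj} = π_{kj} − ½ δ_{kj} tr π`, `Σ_k ∂_k κ_{kj} − ∂_j (tr κ) = Σ_k ∂_k π_{kj}`: the linearised momentum constraint
`div κ − d tr κ` is the divergence of `π`. [cite: MaoOhTao2023, §2.1, (2.5), (2.7)] -/
theorem sum_pd_traceRev_sub_pd_eq (hP : ∀ i j, ContDiff ℝ 1 (P i j)) (x : E3) (j : Fin 3) :
    (∑ k, pd k (fun y ↦ P k j y - (1 / 2 : ℝ) * (if k = j then ∑ l, P l l y else 0)) x) -
        pd j (fun y ↦ ∑ i, (P i i y - (1 / 2 : ℝ) * (∑ l, P l l y))) x =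
      ∑ k, pd k (P k j) x := by
  set T : E3 → ℝ := fun y ↦ ∑ l, P l l y with hT
  have hTd : ContDiff ℝ 1 T := ContDiff.sum fun l _ ↦ hP l l
  have hd1 : ∀ i j y, DifferentiableAt ℝ (P i j) y := fun i j y ↦ (hP i j).differentiable one_ne_zero y
  have hTd1 : ∀ y, DifferentiableAt ℝ T y := fun y ↦ hTd.differentiable one_ne_zero y
  have h1 : ∀ k, pd k (fun y ↦ P k j y - (1 / 2 : ℝ) * (if k = j then ∑ l, P l l y else 0)) x =
      pd k (P k j) x - (1 / 2 : ℝ) * (if k = j then pd k T x else 0) := by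
    intro k
    have hc : DifferentiableAt ℝ (fun y ↦ (1 / 2 : ℝ) * (if k = j then ∑ l, P l l y else 0)) x := by
      by_cases hkj : k = j
      · simp only [hkj, if_true]; exact (hTd1 x).const_mul _
      · simp only [hkj, if_false, mul_zero]; exact differentiableAt_const _
    rw [pd_sub (hd1 k j x) hc]
    by_cases hkj : k = j
    · simp only [hkj, if_true]
      rw [pd_const_mul' _ (hTd1 x)]
    · simp only [hkj, if_false, mul_zero]
      simp [pd]
  have h3 : (fun y ↦ ∑ i, (P i i y - (1 / 2 : ℝ) * (∑ l, P l l y))) =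
      fun y ↦ -(1 / 2 : ℝ) * T y := funext fun y ↦ sum_traceRev_diag P y
  rw [h3, pd_const_mul' _ (hTd1 x)]
  simp only [h1]
  simp only [Finset.sum_sub_distrib, mul_ite, mul_zero, Finset.sum_ite_eq', Finset.mem_univ, if_true]
  ring

end Momentum

end MaoOhTao

end Literature.Geometry.Lorentzian

end
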